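import Mathlib
import HarnessLib
import HarnessLib.Audit
import Summits.HodgeConjecture.HodgeConjecture.Theses.EightfoldTwistedSheafSeeds
import Summits.HodgeConjecture.HodgeConjecture.Theorems.HeckePrymWeilSemiregularSpreadOfBlochLifts
import Literature.AlgebraicGeometry.HodgeTheory.BlochSemiregularSpread
import Literature.AlgebraicGeometry.HodgeTheory.BlochSemiregularityTheorem
import Literature.AlgebraicGeometry.HodgeTheory.FlatFamilyCycleClass
import Literature.AlgebraicGeometry.HodgeTheory.BlochSemiregularCompIso
import Literature.AlgebraicGeometry.HodgeTheory.RegularImmersionIso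
import Literature.AlgebraicGeometry.HodgeTheory.RegularImmersionConormal
import Literature.AlgebraicGeometry.HodgeTheory.ProperOverQuasiProjective
import Literature.AlgebraicGeometry.HodgeTheory.IsoTransport
import Literature.AlgebraicGeometry.HodgeTheory.ClassesSupportedOn

/-!
# Skeleton `Lines/bloch-lifts-fulton` for crux `BlochSpreadEightFour` (stmt-HodgeConjecture-18884)

HONEST FRAMING: a crux PROOF SKELETON (cruxes-workfile class), not a proof. The crux
`Theses.EightfoldTwistedSheafSeeds.BlochSpreadEightFour = BlochSemiregularSpread (2 * 4) 4` (Bloch 1972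
Thm. (7.4) = Buchweitz–Flenner 2003 Thm. 5.2 at relative dimension `8`, codimension `4`, CLASS level) is
NOT proved here: the `sorry`s sit exactly inside the registered `stub_*` declarations. Nothing here proves
rung H2, `WeilSixfolds`, HC_AV or HC.

STRATEGY (line-writer seat `linewriter-hodgeav-h2sheaf` g0, 2026-08-31). The class-level spread is the
composite of two OBJECT-level statements already typed in the tree as named facts and one
commutative-algebra lemma, glued by the LANDED theorem
`Theorems.HeckePrymWeilLine.semiregularSpread_of_blochLifts_of_fulton` (route HeckePrymWeil, line
`semiregular-clean-lci-anchor`, which consumes the same two facts):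

* `stub_blochLifts` — Bloch's semiregularity theorem, OBJECT level (Bloch 1972 Thm. (7.1) with the proof
  of (7.4); Artin 1969 Cor. (2.2)): a Bloch-semiregular l.c.i. `Z₀ ⊂ X₀ = 𝒳_{s₀}` of pure codimension `p`
  whose component classes stay `(p,p)` lifts to a flat family of subschemes over an étale neighbourhood
  of `s₀`. Tree named fact `Bloch1972_semiregularSubschemeLifts` (for all `n, p`; the line uses it at
  `(8, 4)`). [XL as a formalisation: pro-representable hull of the local Hilbert functor, `T¹`-lifting /
  obstruction calculus `ob ∈ H¹(Z₀, N) → H^{p+1}(X₀, Ω^{p-1})`, Artin approximation.]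
* `stub_fultonSpecialises` — the class of a flat family of subschemes is a global class whose fibre
  restrictions are algebraic and which specialises to `c₀ • [component] + (rest)` (Fulton 1998
  Prop. 10.1 (a), Cor. 10.1, Lemma 19.1.1, Cor. 19.2 (b)). Tree named fact
  `fulton1998_flatFamily_cycleClass_specialises`. [L: relative cycle class in Betti cohomology.]
* `stub_codimOfRegularImmersion` — an INTEGRAL closed subscheme cut out by a regular sequence of
  length `p` near each point (the tree's `IsRegularImmersionOfCodim i p`) of a locally Noetherian scheme
  has its generic point in codimension exactly `p` (`𝒪_{X,η}` modulo a regular sequence of length `p` is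
  the field `𝒪_{Z,η}`, so `𝒪_{X,η}` is regular local of dimension `p`; Matsumura Thm. 17.4 / 14.1).
  [M; Mathlib: `RingTheory.Sequence.IsWeaklyRegular`, `ringKrullDim`, `Order.coheight`.] This supplies the
  binder `∃ z, codim (i z) = p` of the glue theorem, which `BlochSemiregularSpread` does not carry.
* `stub_supportAlongChart` — classes supported on `i(Z) ⊂ X₀` pull back, along the chart
  `e : X₀ ≅ 𝒳_{s₀}`, to classes supported on `(i ≫ e)(Z) ⊂ 𝒳_{s₀}` (iso-invariance of
  `classesSupportedOn`, the `classesSupportedOn` analogue of the landed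
  `HodgeTheory.mem_supportedClasses_map_of_iso`). [S/M bookkeeping.]
* `stub_rung_smoothCentre` — RUNG (special case outside the tree's known cells `p = 0`, `n ≤ p`,
  `n ≤ 3` of `BlochSemiregularSpreadCells`): the crux for a SMOOTH seed `Z` (Kodaira–Spencer /
  Bloch §6 regime: the normal bundle is honest, `T¹ = H⁰(N)`, obstructions in `H¹(N)`); first prover
  target; `rung_of_crux` records (sorry-free) that it IS a special case of the crux.

COMPOSITION `BlochSpreadEightFour_of` (sorry-free given the stubs): transport the seed along the chart
(`IsRegularImmersionOfCodim.comp_iso`, `IsBlochSemiregular.comp_iso`, `….isFiniteLocallyFree_conormalSheaf`,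
`coheight_left_base_eq_of_iso`), Hartshorne-projectivity of `f` from quasi-projectivity
(`IsQuasiProjectiveOver.exists_isClosedImmersion_projectiveSpace_tensor_of_isSmoothProjectiveFamily`),
then `semiregularSpread_of_blochLifts_of_fulton`.

References: [Bloch1972Semiregularity] Thm. (7.1), (7.4), Remark (7.5); [BuchweitzFlenner2003] Thm. 5.2;
[Artin1969] Cor. (2.2); [Fulton1998] §10.1, §19.1–19.2; [Matsumura1987] Thm. 14.1, 17.4;
[VoisinTorino1994] Lecture 7 Thm. 2.3–2.4.
-/

-- every declaration of this problem lives in `Summit.HodgeConjecture.HodgeConjecture.…` (summit = sub-problem)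
set_option linter.dupNamespace false

noncomputable section

open CategoryTheory CategoryTheory.Limits AlgebraicGeometry MonoidalCategory
open Literature.AlgebraicGeometry.Motives Literature.AlgebraicGeometry.HodgeTheory
open Literature.AlgebraicGeometry.Deformation
open Literature.AlgebraicTopology.SingularHomology

namespace Summit.HodgeConjecture.HodgeConjecture.Cruxes.BlochSpreadEightFour.BlochLiftsFulton

/-- STUB (open, load-bearing, XL): Bloch's semiregularity theorem at the OBJECT level, relative form
(the tree's named fact, Bloch 1972 Thm. (7.1) + proof of (7.4), Artin 1969 Cor. (2.2)). -/
theorem stub_blochLifts : Bloch1972_semiregularSubschemeLifts := by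
  sorry

/-- STUB (open, load-bearing, L): Fulton's relative cycle class of a flat family of subschemes
specialises to the class of the central fibre and is fibrewise algebraic (the tree's named fact,
Fulton 1998 Prop. 10.1 (a), Cor. 10.1, Lemma 19.1.1, Cor. 19.2 (b)). -/
theorem stub_fultonSpecialises : fulton1998_flatFamily_cycleClass_specialises := by
  sorry

/-- STUB (open, load-bearing, M): an integral closed subscheme which is a regular immersion of
codimension `p` into a locally Noetherian scheme has a point (its generic point) of codimension
exactly `p`. [cite: Matsumura1987, Thm. 14.1 and Thm. 17.4] -/
theorem stub_codimOfRegularImmersion :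
    ∀ {X Z : Scheme.{0}} (i : Z ⟶ X) (p : ℕ) [IsLocallyNoetherian X] [AlgebraicGeometry.IsIntegral Z],
      IsRegularImmersionOfCodim i p → ∃ z : Z, Order.coheight (i.base z) = (p : ℕ∞) := by
  sorry

/-- STUB (open, load-bearing, S/M bookkeeping): classes supported on `i(Z) ⊂ X₀` are carried by the
chart `e : X₀ ≅ X₁` to classes supported on `(i ≫ e)(Z) ⊂ X₁`. [cite: GrothendieckTopology1969, §1] -/
theorem stub_supportAlongChart :
    ∀ {X₀ X₁ : SchemeOver ℂ} (e : X₀ ≅ X₁) {Z : Scheme.{0}} (i : Z ⟶ X₀.left) (k : ℕ)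
      (x₁ : complexBetti X₁ k),
      complexBetti.map e.hom k x₁ ∈ classesSupportedOn X₀ (Set.range i.base) k →
        x₁ ∈ classesSupportedOn X₁ (Set.range (i ≫ e.hom.left).base) k := by
  sorry

/-- RUNG STUB (open, first prover target, M/L): the crux for a SMOOTH semiregular seed `Z ⊂ X₀`
(extra binder `Smooth (i ≫ X₀.hom)`), relative dimension `8`, codimension `4` — outside the tree's
known cells (`p = 0`, `n ≤ p`, `n ≤ 3`). [cite: Bloch1972Semiregularity, §6 and Thm. (7.4)]
[cite: KodairaSpencer1959, Thm. (semi-regular submanifolds)] -/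
theorem stub_rung_smoothCentre :
    ∀ (X₀ : SchemeOver ℂ) (Z : Scheme.{0}) (i : Z ⟶ X₀.left) (x : complexBetti X₀ (2 * 4))
      (𝒳 S : SchemeOver ℂ) (f : 𝒳 ⟶ S) (s₀ : ComplexPoints S) (e : X₀ ≅ fiberOver f s₀)
      (W : complexBetti 𝒳 (2 * 4)),
      AlgebraicGeometry.Smooth (i ≫ X₀.hom) →
      IsClosedImmersion i → IsRegularImmersionOfCodim i 4 → AlgebraicGeometry.IsIntegral Z →
      (∀ z ∈ Set.range i.base, ((4 : ℕ) : ℕ∞) ≤ Order.coheight z) →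
      IsBlochSemiregular i (2 * 4) 4 →
      x ∈ classesSupportedOn X₀ (Set.range i.base) (2 * 4) →
      IsSmoothProjectiveFamily f (2 * 4) → IsQuasiProjectiveOver 𝒳 → IsQuasiProjectiveOver S →
      AlgebraicGeometry.Smooth S.hom →
      (∀ s : ComplexPoints S, IsRationalClass (complexBetti.map (fiberι f s) (2 * 4) W) ∧
        IsOfHodgeType (2 * 4) (fiberOver f s) (2 * 4) 4 4 (complexBetti.map (fiberι f s) (2 * 4) W)) →
      complexBetti.map e.hom (2 * 4) (complexBetti.map (fiberι f s₀) (2 * 4) W) = x →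
      ∃ U : Set (ComplexPoints S), IsOpen U ∧ s₀ ∈ U ∧
        ∀ t ∈ U, complexBetti.map (fiberι f t) (2 * 4) W ∈ algebraicClasses (fiberOver f t) 4 := by
  sorry

/-- Remark (sorry-free): the rung IS the crux restricted to smooth seeds. -/
theorem rung_of_crux
    (h : Summit.HodgeConjecture.HodgeConjecture.Theses.EightfoldTwistedSheafSeeds.BlochSpreadEightFour) :
    ∀ (X₀ : SchemeOver ℂ) (Z : Scheme.{0}) (i : Z ⟶ X₀.left) (x : complexBetti X₀ (2 * 4))
      (𝒳 S : SchemeOver ℂ) (f : 𝒳 ⟶ S) (s₀ : ComplexPoints S) (e : X₀ ≅ fiberOver f s₀)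
      (W : complexBetti 𝒳 (2 * 4)),
      AlgebraicGeometry.Smooth (i ≫ X₀.hom) →
      IsClosedImmersion i → IsRegularImmersionOfCodim i 4 → AlgebraicGeometry.IsIntegral Z →
      (∀ z ∈ Set.range i.base, ((4 : ℕ) : ℕ∞) ≤ Order.coheight z) →
      IsBlochSemiregular i (2 * 4) 4 →
      x ∈ classesSupportedOn X₀ (Set.range i.base) (2 * 4) →
      IsSmoothProjectiveFamily f (2 * 4) → IsQuasiProjectiveOver 𝒳 → IsQuasiProjectiveOver S →
      AlgebraicGeometry.Smooth S.hom →
      (∀ s : ComplexPoints S, IsRationalClass (complexBetti.map (fiberι f s) (2 * 4) W) ∧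
        IsOfHodgeType (2 * 4) (fiberOver f s) (2 * 4) 4 4 (complexBetti.map (fiberι f s) (2 * 4) W)) →
      complexBetti.map e.hom (2 * 4) (complexBetti.map (fiberι f s₀) (2 * 4) W) = x →
      ∃ U : Set (ComplexPoints S), IsOpen U ∧ s₀ ∈ U ∧
        ∀ t ∈ U, complexBetti.map (fiberι f t) (2 * 4) W ∈ algebraicClasses (fiberOver f t) 4 :=
  fun X₀ Z i x 𝒳 S f s₀ e W _ hi hreg hZ hcodim hsr hsupp hf h𝒳 hS hSm hW hx =>
    h X₀ Z i x 𝒳 S f s₀ e W hi hreg hZ hcodim hsr hsupp hf h𝒳 hS hSm hW hx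

/-- **Composition** (the ONLY theorem of this file concluding the crux): the stubs give
`BlochSpreadEightFour` BY NAME. -/
theorem BlochSpreadEightFour_of :
    Summit.HodgeConjecture.HodgeConjecture.Theses.EightfoldTwistedSheafSeeds.BlochSpreadEightFour := by
  intro X₀ Z i x 𝒳 S f s₀ e W hi hreg hZ hcodim hsr hsupp hf h𝒳 hS hSm hW hx
  -- the central fibre is smooth projective, hence locally Noetherian; `Z` is integral
  haveI : IsLocallyNoetherian (fiberOver f s₀).left :=
    IsSmoothProjective.isLocallyNoetherian_holds (hf.isSmoothProjective s₀)
  haveI := hZ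
  -- transport the seed along the chart `e : X₀ ≅ 𝒳_{s₀}`
  have hreg' : IsRegularImmersionOfCodim (i ≫ e.hom.left) 4 := hreg.comp_iso (leftIso e)
  haveI : IsClosedImmersion (i ≫ e.hom.left) := hreg'.isClosedImmersion
  have hlci : IsFiniteLocallyFree (conormalSheaf (i ≫ e.hom.left)) :=
    hreg'.isFiniteLocallyFree_conormalSheaf
  have hsr' : IsBlochSemiregular (i ≫ e.hom.left) (2 * 4) 4 := IsBlochSemiregular.comp_iso e i hsr
  have hcoh : ∀ z : Z, ((4 : ℕ) : ℕ∞) ≤ Order.coheight ((i ≫ e.hom.left).base z) := by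
    intro z
    have h1 : (i ≫ e.hom.left).base z = e.hom.left.base (i.base z) := rfl
    rw [h1, coheight_left_base_eq_of_iso e (i.base z)]
    exact hcodim _ ⟨z, rfl⟩
  have hcohp : ∃ z : Z, Order.coheight ((i ≫ e.hom.left).base z) = ((4 : ℕ) : ℕ∞) :=
    stub_codimOfRegularImmersion (i ≫ e.hom.left) 4 hreg'
  -- Hartshorne projectivity of `f`
  have hproj := IsQuasiProjectiveOver.exists_isClosedImmersion_projectiveSpace_tensor_of_isSmoothProjectiveFamily
    f hf h𝒳
  -- the support of `W|_{X₀}` read in the fibre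
  have hsupp' : complexBetti.map (fiberι f s₀) (2 * 4) W ∈
      classesSupportedOn (fiberOver f s₀) (Set.range (i ≫ e.hom.left).base) (2 * 4) :=
    stub_supportAlongChart e i (2 * 4) _ (hx ▸ hsupp)
  exact Summit.HodgeConjecture.HodgeConjecture.Theorems.HeckePrymWeilLine.semiregularSpread_of_blochLifts_of_fulton
    stub_blochLifts stub_fultonSpecialises f (2 * 4) 4 hf hproj hSm s₀ Z (i ≫ e.hom.left) inferInstance
    hlci hZ hcoh hcohp hsr' W (fun s => (hW s).2) hsupp'

end Summit.HodgeConjecture.HodgeConjecture.Cruxes.BlochSpreadEightFour.BlochLiftsFulton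

end
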